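import Literature.Analysis.FluidPDE.BiotSavartBounds
import Mathlib.Analysis.SpecialFunctions.ImproperIntegrals
import Mathlib.MeasureTheory.Integral.MeanInequalities
import HarnessLib

/-!
# The sup of a Biot–Savart velocity by the `L^∞` and `L²` norms of the vorticity:
# `‖K₃ ∗ ω‖_∞ ≤ 2 (4π)^{-1/3} ‖ω‖_∞^{1/3} ‖ω‖_{L²}^{2/3}` (near/far splitting, explicit constants)

Literature file (topic `Analysis/FluidPDE`), all results proved, no definitions, no named facts;
the `ℝ³` companion of `BiotSavart2DSupInterpolation.lean`. For the Biot–Savart law of `ℝ³`,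
`(K₃ ∗ ω)(x) = ∫ K₃(x − y) ω(y) dy`, `‖K₃(z) h‖ ≤ (4π)⁻¹ ‖h‖ |z|⁻²` (tree `biotSavart`,
`norm_biotSavartKernel_le`), and a vorticity `ω` with `|ω| ≤ M` and `∫ |ω|² < ∞`:

* `norm_biotSavart_le_of_radius` — for every `R > 0` and every `x`,
  `‖(K₃ ∗ ω)(x)‖ ≤ M R + √( ∫|ω|² / (4πR) )`: split the integral at `|x − y| = R`; the near field is
  `≤ (4π)⁻¹ M ∫_{|z|<R} |z|⁻² dz = M R` (tree `lintegral_kernelMajorant`: `∫_{|z|<R}|z|⁻² = 4πR`),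
  the far field is `≤ (4π)⁻¹ (∫_{|z|≥R} |z|⁻⁴ dz)^{1/2} ‖ω‖_{L²} = ‖ω‖_{L²} / √(4πR)` by
  Cauchy–Schwarz and `∫_{|z|≥R} |z|⁻⁴ dz = 4π/R` (polar coordinates);
* `norm_biotSavart_le_rpow_third` — optimising in `R` (`R = a/M` with `a³ = M ∫|ω|² /(4π)`):
  `‖(K₃ ∗ ω)(x)‖ ≤ 2 (4π)^{-1/3} M^{1/3} (∫|ω|²)^{1/3}`, i.e. `≤ C₁ M^{1/3} ℰ^{1/3}` with
  `ℰ = ½∫|ω|²` and `C₁ = 2 (2/(4π))^{1/3}`.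

This is the elementary potential estimate printed (with this proof and these constants) as
Lemma 3.4 of J. Rhodes, *Navier–Stokes Existence and Smoothness via the Self-Defeating Enstrophy
Boundary* (Zenodo 19560332, 2026) — a TRUE lemma of an unrefereed text under adjudication in cell
`ns-claims` (row C142); only this lemma is used, nothing else of that text — and is the `ℝ³`,
`(L², L^∞)` instance of the standard interpolation of a Riesz potential of order one across the
critical index `3` (Majda–Bertozzi 2002, (4.30): `K₃` is homogeneous of degree `−2`; their Lemma 4.5
is the compact-support form `|K₃ ∗ ω|₀ ≤ c R |ω|₀`, tree `norm_biotSavart_le_of_support_subset`).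

No regularity of `ω` is needed beyond a.e.-strong measurability (for Cauchy–Schwarz); the bounds
are on the Bochner integral defining `biotSavart ω x` through `‖∫ f‖ₑ ≤ ∫⁻ ‖f‖ₑ`, as in
`BiotSavartBounds.lean`. The far-field majorant `1_{|z| ≥ R} |z|⁻⁴` and its square root
`1_{|z| ≥ R} |z|⁻²` are written inline as `Set.indicator`s of the complement of `ball 0 R`; physical space is spelled
`EuclideanSpace ℝ (Fin 3)` throughout (no local notation).

## References

* J. Rhodes, *Navier–Stokes Existence and Smoothness via the Self-Defeating Enstrophy Boundary*,
  Zenodo record 19560332 (2026), Lemma 3.4 (8) p. 5 and its proof pp. 5–6. [Rhodes2026]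
* A. J. Majda, A. L. Bertozzi, *Vorticity and Incompressible Flow* (CUP 2002), §4.1.3 (4.30),
  Lemma 4.5 (4.34). [MajdaBertozziCUP2002]

Mathlib/tree search: `lean search 'norm_biotSavart_le'` — `…_of_support_subset`, `…_of_le_dist`,
`…_bracket` (compact support), axisymmetric `…_sqrt_of_isAxisymmetric_of_norm_le`; planar
`norm_biotSavart2D_le_of_radius_L4`; nothing with the `L²` norm of the vorticity on `ℝ³`.
-/

noncomputable section

open MeasureTheory Set Function Filter Metric Real
open _root_.Topology
open scoped ENNReal NNReal

namespace Literature.Analysis.FluidPDE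

/-! ### The far-field radial integral `∫_{|z| ≥ R} |z|⁻⁴ dz = 4π/R` -/

/-- Measurability of the far-field majorant `1_{|z| ≥ R} |z|⁻⁴`. [folklore] -/
private theorem measurable_farMajorant (R : ℝ) :
    Measurable fun z : (EuclideanSpace ℝ (Fin 3)) => (ball (0 : (EuclideanSpace ℝ (Fin 3))) R)ᶜ.indicator (fun z => (‖z‖ ^ 4)⁻¹) z :=
  ((measurable_norm.pow_const 4).inv).indicator measurableSet_ball.compl

/-- The far-field majorant is nonnegative. [folklore] -/
private theorem farMajorant_nonneg (R : ℝ) (z : (EuclideanSpace ℝ (Fin 3))) :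
    0 ≤ (ball (0 : (EuclideanSpace ℝ (Fin 3))) R)ᶜ.indicator (fun z : (EuclideanSpace ℝ (Fin 3)) => (‖z‖ ^ 4)⁻¹) z :=
  indicator_nonneg (fun _ _ => by positivity) z

/-- **`|z|⁻⁴` is integrable away from the origin in `(EuclideanSpace ℝ (Fin 3))`** (`4 > 3 = dim`): on `{|z| ≥ R}`, `R > 0`,
`|z|⁻⁴ ≤ ((1 + R)/R)⁴ (1 + |z|)⁻⁴` and `(1 + |z|)⁻⁴ ∈ L¹((EuclideanSpace ℝ (Fin 3)))` (Mathlib `integrable_one_add_norm`).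
[folklore] -/
private theorem integrable_farMajorant {R : ℝ} (hR : 0 < R) :
    Integrable fun z : (EuclideanSpace ℝ (Fin 3)) => (ball (0 : (EuclideanSpace ℝ (Fin 3))) R)ᶜ.indicator (fun z : (EuclideanSpace ℝ (Fin 3)) => (‖z‖ ^ 4)⁻¹) z := by
  have hJ : Integrable fun z : (EuclideanSpace ℝ (Fin 3)) => (1 + ‖z‖) ^ (-(4 : ℝ)) :=
    integrable_one_add_norm (by rw [finrank_euclideanSpace_fin]; norm_num)
  refine (hJ.const_mul (((1 + R) / R) ^ 4)).mono' (measurable_farMajorant R).aestronglyMeasurable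
    (Eventually.of_forall fun z => ?_)
  rw [Real.norm_of_nonneg (farMajorant_nonneg R z)]
  by_cases hz : z ∈ (ball (0 : (EuclideanSpace ℝ (Fin 3))) R)ᶜ
  · rw [indicator_of_mem hz]
    have hRz : R ≤ ‖z‖ := by simpa [mem_ball, dist_zero_right] using hz
    have hz0 : 0 < ‖z‖ := hR.trans_le hRz
    have hle : 1 + ‖z‖ ≤ (1 + R) / R * ‖z‖ := by
      rw [div_mul_eq_mul_div, le_div_iff₀ hR]
      nlinarith
    have hpow : (1 + ‖z‖) ^ 4 ≤ ((1 + R) / R) ^ 4 * ‖z‖ ^ 4 := by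
      rw [← mul_pow]
      exact pow_le_pow_left₀ (by positivity) hle 4
    rw [Real.rpow_neg (by positivity), show (4 : ℝ) = ((4 : ℕ) : ℝ) by norm_num,
      Real.rpow_natCast]
    calc (‖z‖ ^ 4)⁻¹ = ((1 + R) / R) ^ 4 * (((1 + R) / R) ^ 4 * ‖z‖ ^ 4)⁻¹ := by
          field_simp
      _ ≤ ((1 + R) / R) ^ 4 * ((1 + ‖z‖) ^ 4)⁻¹ := by
          gcongr
  · rw [indicator_of_notMem hz]
    positivity

/-- **Polar coordinates: `∫_{|z| ≥ R} |z|⁻⁴ dz = 4π/R` in `(EuclideanSpace ℝ (Fin 3))`** (`R > 0`): by Mathlib's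
`integral_fun_norm_addHaar`, `∫ f(|z|) dz = 3 |B₁| ∫₀^∞ s² f(s) ds` with `|B₁| = 4π/3`, and
`∫_R^∞ s² · s⁻⁴ ds = 1/R` (`integral_Ioi_rpow_of_lt`). [folklore] -/
private theorem integral_farMajorant {R : ℝ} (hR : 0 < R) :
    ∫ z : (EuclideanSpace ℝ (Fin 3)), (ball (0 : (EuclideanSpace ℝ (Fin 3))) R)ᶜ.indicator (fun z : (EuclideanSpace ℝ (Fin 3)) => (‖z‖ ^ 4)⁻¹) z = 4 * π / R := by
  have hind : (fun z : (EuclideanSpace ℝ (Fin 3)) => (ball (0 : (EuclideanSpace ℝ (Fin 3))) R)ᶜ.indicator (fun z : (EuclideanSpace ℝ (Fin 3)) => (‖z‖ ^ 4)⁻¹) z) =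
      fun z : (EuclideanSpace ℝ (Fin 3)) => (Ici R).indicator (fun s : ℝ => (s ^ 4)⁻¹) ‖z‖ := by
    funext z
    by_cases hz : R ≤ ‖z‖
    · have hz' : z ∈ (ball (0 : (EuclideanSpace ℝ (Fin 3))) R)ᶜ := by simpa [mem_ball, dist_zero_right] using hz
      rw [indicator_of_mem hz', indicator_of_mem (mem_Ici.2 hz)]
    · have hz' : z ∉ (ball (0 : (EuclideanSpace ℝ (Fin 3))) R)ᶜ := by simpa [mem_ball, dist_zero_right] using hz
      rw [indicator_of_notMem hz', indicator_of_notMem (by simpa using hz)]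
  rw [hind, integral_fun_norm_addHaar (volume : Measure (EuclideanSpace ℝ (Fin 3)))
    (fun s : ℝ => (Ici R).indicator (fun s : ℝ => (s ^ 4)⁻¹) s), finrank_euclideanSpace_fin]
  have hinner : ∫ s in Ioi (0 : ℝ), s ^ (3 - 1) • (Ici R).indicator (fun s : ℝ => (s ^ 4)⁻¹) s
      = R⁻¹ := by
    have h1 : EqOn (fun s : ℝ => s ^ (3 - 1) • (Ici R).indicator (fun s : ℝ => (s ^ 4)⁻¹) s)
        ((Ici R).indicator fun s : ℝ => s ^ (-2 : ℝ)) (Ioi 0) := by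
      intro s hs
      have hs0 : (0 : ℝ) < s := hs
      by_cases hsr : R ≤ s
      · simp only [indicator, mem_Ici, hsr, if_true, smul_eq_mul]
        rw [Real.rpow_neg hs0.le, show (2 : ℝ) = ((2 : ℕ) : ℝ) by norm_num, Real.rpow_natCast]
        field_simp
      · simp [indicator, hsr]
    rw [setIntegral_congr_fun measurableSet_Ioi h1, setIntegral_indicator measurableSet_Ici,
      show Ioi (0 : ℝ) ∩ Ici R = Ici R from
        inter_eq_right.2 fun s hs => hR.trans_le (mem_Ici.1 hs),
      integral_Ici_eq_integral_Ioi, integral_Ioi_rpow_of_lt (by norm_num) hR]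
    rw [show (-2 : ℝ) + 1 = -1 by norm_num, Real.rpow_neg_one]
    ring
  rw [hinner, measureReal_def, EuclideanSpace.volume_ball_fin_three]
  rw [ENNReal.toReal_mul, ← ENNReal.ofReal_pow zero_le_one, one_pow, ENNReal.toReal_ofReal zero_le_one,
    ENNReal.toReal_ofReal (by positivity : (0 : ℝ) ≤ π * 4 / 3)]
  simp only [nsmul_eq_mul, smul_eq_mul]
  field_simp
  ring

/-- The lower Lebesgue integral of the far-field majorant: `∫⁻ 1_{|z|≥R} |z|⁻⁴ = 4π/R`. [folklore] -/
private theorem lintegral_farMajorant {R : ℝ} (hR : 0 < R) :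
    ∫⁻ z : (EuclideanSpace ℝ (Fin 3)), ENNReal.ofReal ((ball (0 : (EuclideanSpace ℝ (Fin 3))) R)ᶜ.indicator (fun z : (EuclideanSpace ℝ (Fin 3)) => (‖z‖ ^ 4)⁻¹) z) =
      ENNReal.ofReal (4 * π / R) := by
  rw [← integral_farMajorant hR, ofReal_integral_eq_lintegral_ofReal (integrable_farMajorant hR)
    (Eventually.of_forall (farMajorant_nonneg R))]

/-! ### The split bound at radius `R` -/

/-- Pointwise splitting of the Biot–Savart integrand at distance `R` from `x`: for `|ω| ≤ M`,
`‖K₃(x − y) ω(y)‖ ≤ (4π)⁻¹ ( M · 1_{|x−y|<R} |x − y|⁻² + 1_{|x−y|≥R} |x − y|⁻² · ‖ω(y)‖ )`.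
[folklore] -/
private theorem norm_kernel_apply_le_split {ω : (EuclideanSpace ℝ (Fin 3)) → (EuclideanSpace ℝ (Fin 3))} {M R : ℝ} (hM : ∀ y, ‖ω y‖ ≤ M)
    (x y : (EuclideanSpace ℝ (Fin 3))) :
    ‖biotSavartKernel (x - y) (ω y)‖ ≤
      (4 * π)⁻¹ * M * kernelMajorant R (x - y) +
        (4 * π)⁻¹ * ((ball (0 : (EuclideanSpace ℝ (Fin 3))) R)ᶜ.indicator (fun z : (EuclideanSpace ℝ (Fin 3)) => (‖z‖ ^ 2)⁻¹) (x - y) * ‖ω y‖) := by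
  have hM0 : 0 ≤ M := (norm_nonneg _).trans (hM y)
  have hK := norm_biotSavartKernel_le (x - y) (ω y)
  by_cases hxy : ‖x - y‖ < R
  · have hnear : kernelMajorant R (x - y) = (‖x - y‖ ^ 2)⁻¹ := by
      simp [kernelMajorant, indicator, hxy]
    have hfar : (ball (0 : (EuclideanSpace ℝ (Fin 3))) R)ᶜ.indicator (fun z : (EuclideanSpace ℝ (Fin 3)) => (‖z‖ ^ 2)⁻¹) (x - y) = 0 :=
      indicator_of_notMem (by simpa [mem_ball, dist_zero_right] using hxy) _
    rw [hnear, hfar, zero_mul, mul_zero, add_zero]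
    calc ‖biotSavartKernel (x - y) (ω y)‖ ≤ (4 * π)⁻¹ * ‖ω y‖ * (‖x - y‖ ^ 2)⁻¹ := hK
      _ ≤ (4 * π)⁻¹ * M * (‖x - y‖ ^ 2)⁻¹ := by gcongr; exact hM y
  · have hnear : kernelMajorant R (x - y) = 0 := by
      simp [kernelMajorant, indicator, hxy]
    have hfar : (ball (0 : (EuclideanSpace ℝ (Fin 3))) R)ᶜ.indicator (fun z : (EuclideanSpace ℝ (Fin 3)) => (‖z‖ ^ 2)⁻¹) (x - y) = (‖x - y‖ ^ 2)⁻¹ :=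
      indicator_of_mem (by simpa [mem_ball, dist_zero_right] using hxy) _
    rw [hnear, hfar, mul_zero, zero_add]
    calc ‖biotSavartKernel (x - y) (ω y)‖ ≤ (4 * π)⁻¹ * ‖ω y‖ * (‖x - y‖ ^ 2)⁻¹ := hK
      _ = (4 * π)⁻¹ * ((‖x - y‖ ^ 2)⁻¹ * ‖ω y‖) := by ring

/-- The square of the far-field factor `1_{|z|≥R} |z|⁻²` is the far-field majorant, at the level of
`ℝ≥0∞`-valued functions raised to the real power `2`. [folklore] -/
private theorem ofReal_farFactor_rpow_two (R : ℝ) (z : (EuclideanSpace ℝ (Fin 3))) :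
    ENNReal.ofReal ((ball (0 : (EuclideanSpace ℝ (Fin 3))) R)ᶜ.indicator (fun z : (EuclideanSpace ℝ (Fin 3)) => (‖z‖ ^ 2)⁻¹) z) ^ (2 : ℝ) =
      ENNReal.ofReal ((ball (0 : (EuclideanSpace ℝ (Fin 3))) R)ᶜ.indicator (fun z : (EuclideanSpace ℝ (Fin 3)) => (‖z‖ ^ 4)⁻¹) z) := by
  rw [ENNReal.rpow_two, ← ENNReal.ofReal_pow (indicator_nonneg (fun _ _ => by positivity) z)]
  congr 1
  by_cases hz : z ∈ (ball (0 : (EuclideanSpace ℝ (Fin 3))) R)ᶜ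
  · rw [indicator_of_mem hz, indicator_of_mem hz]
    ring
  · rw [indicator_of_notMem hz, indicator_of_notMem hz]
    ring

/-- **The split bound in `ℝ≥0∞` form**: for `ω` a.e.-strongly measurable with `|ω| ≤ M` and every
`R > 0`, `‖(K₃ ∗ ω)(x)‖ₑ ≤ M R + (4π)⁻¹ (4π/R)^{1/2} (∫⁻ ‖ω‖ₑ²)^{1/2}` (near field: the radial
integral `4πR`; far field: Cauchy–Schwarz and the radial integral `4π/R`).
[cite: Rhodes2026, Lemma 3.4 proof p.5 l.59 – p.6 l.9] -/
theorem enorm_biotSavart_le_of_radius {ω : (EuclideanSpace ℝ (Fin 3)) → (EuclideanSpace ℝ (Fin 3))} {M : ℝ} (hω : AEStronglyMeasurable ω volume)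
    (hM : ∀ y, ‖ω y‖ ≤ M) {R : ℝ} (hR : 0 < R) (x : (EuclideanSpace ℝ (Fin 3))) :
    ‖biotSavart ω x‖ₑ ≤ ENNReal.ofReal (M * R) +
      ENNReal.ofReal ((4 * π)⁻¹) * (ENNReal.ofReal (4 * π / R)) ^ (1 / 2 : ℝ) *
        (∫⁻ y, ‖ω y‖ₑ ^ (2 : ℝ)) ^ (1 / 2 : ℝ) := by
  have hM0 : 0 ≤ M := (norm_nonneg _).trans (hM x)
  have hc : 0 ≤ (4 * π)⁻¹ := by positivity
  -- the two `ℝ≥0∞`-valued integrands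
  set f : (EuclideanSpace ℝ (Fin 3)) → ℝ≥0∞ := fun y =>
    ENNReal.ofReal ((ball (0 : (EuclideanSpace ℝ (Fin 3))) R)ᶜ.indicator (fun z : (EuclideanSpace ℝ (Fin 3)) => (‖z‖ ^ 2)⁻¹) (x - y)) with hf
  set g : (EuclideanSpace ℝ (Fin 3)) → ℝ≥0∞ := fun y => ‖ω y‖ₑ with hg
  have hfm : Measurable f := by
    refine Measurable.ennreal_ofReal ?_
    exact (((measurable_norm.pow_const 2).inv).indicator measurableSet_ball.compl).comp
      (measurable_const.sub measurable_id)
  have hgm : AEMeasurable g volume := hω.enorm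
  have hkm : Measurable fun y : (EuclideanSpace ℝ (Fin 3)) => ENNReal.ofReal (kernelMajorant R (x - y)) :=
    ((measurable_kernelMajorant R).comp (measurable_const.sub measurable_id)).ennreal_ofReal
  -- pointwise split, in `ℝ≥0∞`
  have hpt : ∀ y, ‖biotSavartKernel (x - y) (ω y)‖ₑ ≤
      ENNReal.ofReal ((4 * π)⁻¹ * M) * ENNReal.ofReal (kernelMajorant R (x - y)) +
        ENNReal.ofReal ((4 * π)⁻¹) * (f y * g y) := by
    intro y
    have hi0 : 0 ≤ (ball (0 : (EuclideanSpace ℝ (Fin 3))) R)ᶜ.indicator (fun z : (EuclideanSpace ℝ (Fin 3)) => (‖z‖ ^ 2)⁻¹) (x - y) :=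
      indicator_nonneg (fun _ _ => by positivity) _
    have e1 : ENNReal.ofReal ((4 * π)⁻¹ * M * kernelMajorant R (x - y)) =
        ENNReal.ofReal ((4 * π)⁻¹ * M) * ENNReal.ofReal (kernelMajorant R (x - y)) :=
      ENNReal.ofReal_mul (mul_nonneg hc hM0)
    have e2 : ENNReal.ofReal ((4 * π)⁻¹ *
        ((ball (0 : (EuclideanSpace ℝ (Fin 3))) R)ᶜ.indicator (fun z : (EuclideanSpace ℝ (Fin 3)) => (‖z‖ ^ 2)⁻¹) (x - y) * ‖ω y‖)) =
        ENNReal.ofReal ((4 * π)⁻¹) * (f y * g y) := by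
      rw [ENNReal.ofReal_mul hc, ENNReal.ofReal_mul hi0, ofReal_norm]
    rw [← ofReal_norm]
    calc ENNReal.ofReal ‖biotSavartKernel (x - y) (ω y)‖
        ≤ ENNReal.ofReal ((4 * π)⁻¹ * M * kernelMajorant R (x - y) +
            (4 * π)⁻¹ * ((ball (0 : (EuclideanSpace ℝ (Fin 3))) R)ᶜ.indicator (fun z : (EuclideanSpace ℝ (Fin 3)) => (‖z‖ ^ 2)⁻¹) (x - y) * ‖ω y‖)) :=
          ENNReal.ofReal_le_ofReal (norm_kernel_apply_le_split (R := R) hM x y)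
      _ = _ := by
          rw [ENNReal.ofReal_add (mul_nonneg (mul_nonneg hc hM0) (kernelMajorant_nonneg _ _))
            (mul_nonneg hc (mul_nonneg hi0 (norm_nonneg _))), e1, e2]
  -- integrate
  have h1 : ‖biotSavart ω x‖ₑ ≤ ∫⁻ y, ‖biotSavartKernel (x - y) (ω y)‖ₑ := by
    rw [biotSavart]
    exact enorm_integral_le_lintegral_enorm _
  refine h1.trans ((lintegral_mono hpt).trans ?_)
  have hfg : AEMeasurable (fun y => f y * g y) volume := hfm.aemeasurable.mul hgm
  rw [lintegral_add_left (hkm.const_mul _), lintegral_const_mul _ hkm,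
    lintegral_const_mul'' _ hfg]
  -- near field
  have hnear : ∫⁻ y, ENNReal.ofReal (kernelMajorant R (x - y)) = ENNReal.ofReal (4 * π * R) := by
    rw [lintegral_sub_left_eq_self (μ := (volume : Measure (EuclideanSpace ℝ (Fin 3))))
      (fun z => ENNReal.ofReal (kernelMajorant R z)) x]
    exact lintegral_kernelMajorant hR.le
  -- far field: Cauchy–Schwarz
  have hfar : ∫⁻ y, f y * g y ≤
      (ENNReal.ofReal (4 * π / R)) ^ (1 / 2 : ℝ) * (∫⁻ y, ‖ω y‖ₑ ^ (2 : ℝ)) ^ (1 / 2 : ℝ) := by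
    have hH := ENNReal.lintegral_mul_le_Lp_mul_Lq volume Real.HolderConjugate.two_two
      hfm.aemeasurable hgm
    simp only [Pi.mul_apply] at hH
    refine hH.trans ?_
    have hf2 : ∫⁻ y, f y ^ (2 : ℝ) = ENNReal.ofReal (4 * π / R) := by
      simp_rw [hf, ofReal_farFactor_rpow_two]
      rw [lintegral_sub_left_eq_self (μ := (volume : Measure (EuclideanSpace ℝ (Fin 3))))
        (fun z => ENNReal.ofReal ((ball (0 : (EuclideanSpace ℝ (Fin 3))) R)ᶜ.indicator (fun z : (EuclideanSpace ℝ (Fin 3)) => (‖z‖ ^ 4)⁻¹) z)) x]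
      exact lintegral_farMajorant hR
    rw [hf2]
  calc ENNReal.ofReal ((4 * π)⁻¹ * M) * (∫⁻ y, ENNReal.ofReal (kernelMajorant R (x - y))) +
        ENNReal.ofReal ((4 * π)⁻¹) * ∫⁻ y, f y * g y
      ≤ ENNReal.ofReal ((4 * π)⁻¹ * M) * ENNReal.ofReal (4 * π * R) +
        ENNReal.ofReal ((4 * π)⁻¹) * ((ENNReal.ofReal (4 * π / R)) ^ (1 / 2 : ℝ) *
          (∫⁻ y, ‖ω y‖ₑ ^ (2 : ℝ)) ^ (1 / 2 : ℝ)) := by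
        rw [hnear]
        exact add_le_add le_rfl (mul_le_mul' le_rfl hfar)
    _ = ENNReal.ofReal (M * R) + ENNReal.ofReal ((4 * π)⁻¹) * (ENNReal.ofReal (4 * π / R)) ^ (1 / 2 : ℝ) *
        (∫⁻ y, ‖ω y‖ₑ ^ (2 : ℝ)) ^ (1 / 2 : ℝ) := by
        rw [← ENNReal.ofReal_mul (mul_nonneg hc hM0)]
        have hπ : π ≠ 0 := pi_pos.ne'
        have e : (4 * π)⁻¹ * M * (4 * π * R) = M * R := by field_simp
        rw [e, mul_assoc]

/-- **The split bound (Rhodes 2026, proof of Lemma 3.4: near field `≤ MR`, far field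
`≤ √(2ℰ)/√(4πR)`)**: for `ω` a.e.-strongly measurable with `|ω| ≤ M` and `∫|ω|² < ∞`, every
`R > 0` and every `x`, `‖(K₃ ∗ ω)(x)‖ ≤ M R + √( ∫|ω|² / (4πR) )`.
[cite: Rhodes2026, Lemma 3.4 proof p.5 l.59 – p.6 l.9] -/
theorem norm_biotSavart_le_of_radius {ω : (EuclideanSpace ℝ (Fin 3)) → (EuclideanSpace ℝ (Fin 3))} {M : ℝ} (hω : AEStronglyMeasurable ω volume)
    (hM : ∀ y, ‖ω y‖ ≤ M) (hI : Integrable (fun y => ‖ω y‖ ^ 2)) {R : ℝ} (hR : 0 < R) (x : (EuclideanSpace ℝ (Fin 3))) :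
    ‖biotSavart ω x‖ ≤ M * R + Real.sqrt ((∫ y, ‖ω y‖ ^ 2) / (4 * π * R)) := by
  have hM0 : 0 ≤ M := (norm_nonneg _).trans (hM x)
  have hI0 : 0 ≤ ∫ y, ‖ω y‖ ^ 2 := integral_nonneg fun y => sq_nonneg _
  have h := enorm_biotSavart_le_of_radius hω hM hR x
  -- `∫⁻ ‖ω‖ₑ² = ofReal (∫ ‖ω‖²)`
  have hI2 : ∫⁻ y, ‖ω y‖ₑ ^ (2 : ℝ) = ENNReal.ofReal (∫ y, ‖ω y‖ ^ 2) := by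
    rw [ofReal_integral_eq_lintegral_ofReal hI (Eventually.of_forall fun y => sq_nonneg _)]
    refine lintegral_congr fun y => ?_
    rw [ENNReal.rpow_two, ← ofReal_norm, ENNReal.ofReal_pow (norm_nonneg _)]
  have hc : 0 ≤ (4 * π)⁻¹ := by positivity
  rw [hI2, ENNReal.ofReal_rpow_of_nonneg (x := 4 * π / R) (by positivity) (by norm_num),
    ENNReal.ofReal_rpow_of_nonneg hI0 (by norm_num),
    ← ENNReal.ofReal_mul (p := (4 * π)⁻¹) hc,
    ← ENNReal.ofReal_mul (p := (4 * π)⁻¹ * (4 * π / R) ^ (1 / 2 : ℝ)) (by positivity),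
    ← ENNReal.ofReal_add (p := M * R) (q := (4 * π)⁻¹ * (4 * π / R) ^ (1 / 2 : ℝ) *
      (∫ y, ‖ω y‖ ^ 2) ^ (1 / 2 : ℝ)) (by positivity) (by positivity),
    ← ofReal_norm] at h
  have h' := (ENNReal.ofReal_le_ofReal_iff (by positivity)).1 h
  refine h'.trans (le_of_eq ?_)
  congr 1
  rw [← Real.sqrt_eq_rpow, ← Real.sqrt_eq_rpow, ← Real.sqrt_sq hc, ← Real.sqrt_mul (sq_nonneg _),
    ← Real.sqrt_mul (x := ((4 * π)⁻¹) ^ 2 * (4 * π / R)) (by positivity)]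
  congr 1
  have hπ : π ≠ 0 := pi_pos.ne'
  field_simp

/-- If `|ω| ≤ 0` the Biot–Savart velocity vanishes. [folklore] -/
private theorem biotSavart_eq_zero_of_norm_le_zero {ω : (EuclideanSpace ℝ (Fin 3)) → (EuclideanSpace ℝ (Fin 3))} (hM : ∀ y, ‖ω y‖ ≤ 0) (x : (EuclideanSpace ℝ (Fin 3))) :
    biotSavart ω x = 0 := by
  have hω : ∀ y, ω y = 0 := fun y => norm_le_zero_iff.1 (hM y)
  rw [biotSavart]
  simp [hω]

/-- If `∫|ω|² = 0` (with `|ω|²` integrable) the Biot–Savart velocity vanishes (`ω = 0` a.e.).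
[folklore] -/
private theorem biotSavart_eq_zero_of_integral_sq_eq_zero {ω : (EuclideanSpace ℝ (Fin 3)) → (EuclideanSpace ℝ (Fin 3))}
    (hI : Integrable (fun y => ‖ω y‖ ^ 2)) (h0 : ∫ y, ‖ω y‖ ^ 2 = 0) (x : (EuclideanSpace ℝ (Fin 3))) :
    biotSavart ω x = 0 := by
  have hae : (fun y => ‖ω y‖ ^ 2) =ᵐ[volume] 0 :=
    (integral_eq_zero_iff_of_nonneg (fun y => sq_nonneg _) hI).1 h0
  rw [biotSavart]
  refine integral_eq_zero_of_ae (hae.mono fun y hy => ?_)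
  have hy' : ω y = 0 := by
    have : ‖ω y‖ ^ 2 = 0 := hy
    exact norm_eq_zero.1 (pow_eq_zero_iff two_ne_zero |>.1 this)
  simp [hy']

/-- **`‖K₃ ∗ ω‖_∞ ≤ 2 (4π)^{-1/3} ‖ω‖_∞^{1/3} ‖ω‖_{L²}^{2/3}`** (Rhodes 2026, Lemma 3.4 (8):
`|u(x)| ≤ C₁ M^{1/3} ℰ^{1/3}`, `ℰ = ½‖ω‖²_{L²}`, `C₁ = 2(2/(4π))^{1/3}`): for `ω` a.e.-strongly
measurable with `|ω| ≤ M` and `∫|ω|² < ∞`, every `x`,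
`‖(K₃ ∗ ω)(x)‖ ≤ 2 · ((4π)⁻¹)^{1/3} · M^{1/3} · (∫|ω|²)^{1/3}` — the split bound at the optimal radius
`R = a/M`, `a = ((4π)⁻¹ M ∫|ω|²)^{1/3}` (both halves equal `a`); the degenerate cases `M = 0`,
`∫|ω|² = 0` have `K₃ ∗ ω = 0`. [cite: Rhodes2026, Lemma 3.4 (8) p.5 l.44–58, proof p.5 l.59 – p.6 l.23] -/
theorem norm_biotSavart_le_rpow_third {ω : (EuclideanSpace ℝ (Fin 3)) → (EuclideanSpace ℝ (Fin 3))} {M : ℝ} (hω : AEStronglyMeasurable ω volume)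
    (hM : ∀ y, ‖ω y‖ ≤ M) (hI : Integrable (fun y => ‖ω y‖ ^ 2)) (x : (EuclideanSpace ℝ (Fin 3))) :
    ‖biotSavart ω x‖ ≤
      2 * ((4 * π)⁻¹) ^ (1 / 3 : ℝ) * M ^ (1 / 3 : ℝ) * (∫ y, ‖ω y‖ ^ 2) ^ (1 / 3 : ℝ) := by
  have hM0 : 0 ≤ M := (norm_nonneg _).trans (hM x)
  set I : ℝ := ∫ y, ‖ω y‖ ^ 2 with hIdef
  have hI0 : 0 ≤ I := integral_nonneg fun y => sq_nonneg _
  have hrhs : 0 ≤ 2 * ((4 * π)⁻¹) ^ (1 / 3 : ℝ) * M ^ (1 / 3 : ℝ) * I ^ (1 / 3 : ℝ) := by positivity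
  rcases hM0.eq_or_lt with hM00 | hMpos
  · rw [biotSavart_eq_zero_of_norm_le_zero (fun y => (hM y).trans_eq hM00.symm) x, norm_zero]
    exact hrhs
  rcases hI0.eq_or_lt with hI00 | hIpos
  · rw [biotSavart_eq_zero_of_integral_sq_eq_zero hI hI00.symm x, norm_zero]
    exact hrhs
  -- the optimal radius
  set a : ℝ := ((4 * π)⁻¹ * M * I) ^ (1 / 3 : ℝ) with ha
  have ha0 : 0 < a := by positivity
  have ha3 : a ^ 3 = (4 * π)⁻¹ * M * I := by
    rw [ha, ← Real.rpow_natCast, ← Real.rpow_mul (by positivity)]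
    norm_num
  set R : ℝ := a / M with hRdef
  have hR : 0 < R := div_pos ha0 hMpos
  have h := norm_biotSavart_le_of_radius hω hM hI hR x
  have hnear : M * R = a := by rw [hRdef]; field_simp
  have hfar : Real.sqrt (I / (4 * π * R)) = a := by
    rw [Real.sqrt_eq_iff_eq_sq (by positivity) ha0.le, hRdef]
    have hπ : π ≠ 0 := pi_pos.ne'
    field_simp
    have : 4 * π * a ^ 3 = M * I := by rw [ha3]; field_simp
    nlinarith [this]
  rw [hnear, hfar] at h
  refine h.trans (le_of_eq ?_)
  rw [ha, Real.mul_rpow (by positivity) hI0, Real.mul_rpow (by positivity) hM0]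
  ring

end Literature.Analysis.FluidPDE

end
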